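import Literature.AlgebraicGeometry.Resolution.RsopMonomialIdeals
import Literature.AlgebraicGeometry.Resolution.MarkedIdeals
import HarnessLib

/-!
# Simple normal crossings from parts of regular systems of parameters

Topic: `Literature/AlgebraicGeometry/Resolution`. The condition `HasSNCWith E C` of
`MarkedIdeals.lean` (BGMW 2011, Def. 3.1.1 on the boundary `E` and Def. 3.1.3 (2) on the centre
`C`: at every point a FULL regular system of parameters `u₁, …, u_d`, `d = emb dim`, adapted to
the divisors of `E` through the point and to `C`) is in practice verified by exhibiting only the
relevant parameters — the local equations of the divisors through the point and of the centre —
and checking that they form PART of a regular system of parameters (`IsRsopPart`,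
`RsopMonomialIdeals.lean`; e.g. via the quotient criterion
`IsRsopPart.of_isRegularLocalRing_quotient`, Matsumura Thm. 14.2). This file PROVES the two
directions of that reformulation, used when simple normal crossings are established in the
fibres of a family (spreading out of resolutions, `SpreadsShapedFromGenericPoint`,
`CanonicalResolutionSpread.lean`) from coordinates pulled back along étale charts or from the
regularity of intersections:

* `hasSNCWith_of_isRsopPart_labels` — **labelled rsop-part data give `HasSNCWith`**: if at
  every `x` there is a part `z : Fin m → 𝒪_{X,x}` of a regular system of parameters, an
  injective labelling of the divisors of `E` through `x` by indices with `D_x = (z_{ι D})`, and,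
  when `x ∈ V(C)`, a subset `S` with `C_x = (z_i : i ∈ S)`, then `HasSNCWith E C` (extend `z` to
  a minimal basis of `𝔪_x`, `IsRsopPart.exists_rsop`);
* `HasSNCWith.exists_isRsopPart_labels` — the converse (a regular system of parameters is a
  part of itself); `hasSNCWith_iff_isRsopPart_labels`.

## Sources

* E. Bierstone, D. Grigoriev, P. Milman, J. Włodarczyk, arXiv:1206.3090, Def. 3.1.1,
  Def. 3.1.3 (2). [BierstoneGrigorievMilmanWlodarczyk2011]
* H. Matsumura, *Commutative Ring Theory* (1986), §14, Thm. 14.2. [Matsumura1987]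
-/

noncomputable section

open CategoryTheory AlgebraicGeometry TopologicalSpace IsLocalRing

namespace Literature.AlgebraicGeometry.Resolution

universe u

variable {X : Scheme.{u}}

/-- **Labelled rsop-part data give simple normal crossings**: suppose that at every point `x`
of `X` there are a part `z₁, …, z_m` of a regular system of parameters of `𝒪_{X,x}`, an
injective labelling `ι` of the divisors of `E` through `x` with `D_x = (z_{ι D})`, and, if
`x ∈ V(C)`, a set `S` of indices with `C_x = (z_i : i ∈ S)`. Then `E` has simple normal
crossings and `C` has simple normal crossings with `E` (`HasSNCWith E C`, BGMW Def. 3.1.1 /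
Def. 3.1.3 (2)): extend `z` to a minimal basis of `𝔪_x` (`IsRsopPart.exists_rsop`).
[cite: BierstoneGrigorievMilmanWlodarczyk2011, Def. 3.1.1 and Def. 3.1.3 (2)] -/
theorem hasSNCWith_of_isRsopPart_labels (E : List X.IdealSheafData) (C : X.IdealSheafData)
    (h : ∀ x : X, ∃ (m : ℕ) (z : Fin m → X.presheaf.stalk x), IsRsopPart z ∧
      (∃ ι : {D : X.IdealSheafData // D ∈ E ∧ x ∈ D.support} → Fin m,
        Function.Injective ι ∧ ∀ D, stalkIdeal D.1 x = Ideal.span {z (ι D)}) ∧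
      (x ∈ C.support → ∃ S : Set (Fin m), stalkIdeal C x = Ideal.span (z '' S))) :
    HasSNCWith E C := by
  intro x
  obtain ⟨m, z, hz, ⟨ι, hι, hιD⟩, hC⟩ := h x
  haveI := hz.isRegularLocalRing
  obtain ⟨e, v, hd, hv, hvz⟩ := hz.exists_rsop
  let σ : Fin (maximalIdeal (X.presheaf.stalk x)).spanFinrank ≃ Fin (m + e) := finCongr hd
  have hvσ : ∀ i : Fin m, (v ∘ σ) (σ.symm (Fin.castAdd e i)) = z i := fun i => by
    simp only [Function.comp_apply, Equiv.apply_symm_apply, hvz]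
  refine ⟨inferInstance, v ∘ σ, ?_, ⟨fun D => σ.symm (Fin.castAdd e (ι D)), ?_, ?_⟩, ?_⟩
  · rw [σ.surjective.range_comp, hv]
  · exact σ.symm.injective.comp ((Fin.castAdd_injective m e).comp hι)
  · intro D
    rw [hιD D, hvσ]
  · intro hx
    obtain ⟨S, hS⟩ := hC hx
    refine ⟨(fun i => σ.symm (Fin.castAdd e i)) '' S, ?_⟩
    rw [hS, Set.image_image]
    congr 1
    exact Set.image_congr fun i _ => (hvσ i).symm

/-- **Conversely, simple normal crossings give labelled rsop-part data** (the minimal basis of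
`𝔪_x` of the definition is a part of a regular system of parameters). [folklore] -/
theorem HasSNCWith.exists_isRsopPart_labels {E : List X.IdealSheafData} {C : X.IdealSheafData}
    (h : HasSNCWith E C) (x : X) :
    ∃ (m : ℕ) (z : Fin m → X.presheaf.stalk x), IsRsopPart z ∧
      (∃ ι : {D : X.IdealSheafData // D ∈ E ∧ x ∈ D.support} → Fin m,
        Function.Injective ι ∧ ∀ D, stalkIdeal D.1 x = Ideal.span {z (ι D)}) ∧
      (x ∈ C.support → ∃ S : Set (Fin m), stalkIdeal C x = Ideal.span (z '' S)) := by
  obtain ⟨hreg, u, hu, hE, hC⟩ := h x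
  haveI := hreg
  refine ⟨_, u, ?_, hE, hC⟩
  have := isRsopPart_comp_of_rsop rfl u hu id Function.injective_id
  simpa using this

/-- `HasSNCWith E C` **iff** every point carries labelled rsop-part data for `E` and `C`.
[cite: BierstoneGrigorievMilmanWlodarczyk2011, Def. 3.1.1 and Def. 3.1.3 (2)] -/
theorem hasSNCWith_iff_isRsopPart_labels (E : List X.IdealSheafData) (C : X.IdealSheafData) :
    HasSNCWith E C ↔ ∀ x : X, ∃ (m : ℕ) (z : Fin m → X.presheaf.stalk x), IsRsopPart z ∧
      (∃ ι : {D : X.IdealSheafData // D ∈ E ∧ x ∈ D.support} → Fin m,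
        Function.Injective ι ∧ ∀ D, stalkIdeal D.1 x = Ideal.span {z (ι D)}) ∧
      (x ∈ C.support → ∃ S : Set (Fin m), stalkIdeal C x = Ideal.span (z '' S)) :=
  ⟨fun h x => h.exists_isRsopPart_labels x, hasSNCWith_of_isRsopPart_labels E C⟩

/-- The version for `HasSNC E` (no centre): labelled rsop-part data for the divisors alone.
[cite: BierstoneGrigorievMilmanWlodarczyk2011, Def. 3.1.1] -/
theorem hasSNC_of_isRsopPart_labels (E : List X.IdealSheafData)
    (h : ∀ x : X, ∃ (m : ℕ) (z : Fin m → X.presheaf.stalk x), IsRsopPart z ∧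
      ∃ ι : {D : X.IdealSheafData // D ∈ E ∧ x ∈ D.support} → Fin m,
        Function.Injective ι ∧ ∀ D, stalkIdeal D.1 x = Ideal.span {z (ι D)}) :
    HasSNC E := by
  refine hasSNCWith_of_isRsopPart_labels E ⊤ fun x => ?_
  obtain ⟨m, z, hz, hE⟩ := h x
  refine ⟨m, z, hz, hE, fun hx => absurd hx ?_⟩
  rw [Scheme.IdealSheafData.support_top]
  exact id

end Literature.AlgebraicGeometry.Resolution

end
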